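import Literature.NumberTheory.Automorphic.ShimuraCurveCartanLevel
import Literature.NumberTheory.Automorphic.ShimuraCurveCartanLevelHeckeCosets
import Literature.NumberTheory.Automorphic.ShimuraCurveHeckeDegree
import Literature.NumberTheory.Automorphic.ShimuraCurveCartanLevelMapDegree
import HarnessLib

/-!
# Cartan-level Shimura curves: the DEGREE `ℓ + 1` of the Hecke correspondence `T_ℓ` at a good prime, and the degree of a
# parametrisation that factors through an isogeny `[n]` (two named facts over `CartanLevelCurveData` ∕ `CartanParametrizationData`)

Topic `NumberTheory/Automorphic`; TWO named literature facts (`def … : Prop`, D-0014; no theorem, no `sorry`, no instance, no notation),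
stated over the tree's analytic vocabulary of `ShimuraCurveCartanLevel.lean` (`CartanLevelCurveData D M C`: an order `O` of the indefinite
quaternion algebra of discriminant `D` which is Eichler of level `M` off `C` and non-split Cartan at the primes of `C`; `Γ = X.Gamma = ι(O¹)`;
`X.heckeSet n = ι(O(n))`, `X.heckeSetoid n` = left `Γ`-cosets on it, `X.heckeFun n` = `T_n`; `CartanParametrizationData X W` with its
`form`, Néron lattice `L.lattice`, `deg`, `deg_spec`). Filed by the BSD cell `bsd-stepL` (seat `bsd-stepL-tam3-p1` g27, LEAD of crux
stmt-BirchSwinnertonDyer-24801 `CartanOnePlaceDegreeLawAtThree`, line `Lines/lattice.lean`): these are the two PRINT inputs of the descent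
clause (D3) `CartanCover.DescentNonsplitAtThree` of that line, whose Hecke ∕ Eisenstein core is proved in the tree
(`Theorems/ClassRecordThreeEulerHalvesAtThreeCartanCover{HeckePeriods,Eisenstein}.lean`).

* `cartanLevel_card_heckeCosets_eq` — **`deg T_ℓ = ℓ + 1` at a good prime.** For `ℓ ∤ D·M·∏_C q` the coset space `Γ∖ι(O(ℓ))` is finite
  with `ℓ + 1` elements. PRINT: locally at `ℓ` the order is `M₂(ℤ_ℓ)` and the integral left ideals of reduced norm `ℓ` are the `ℓ + 1`
  lattices of index `ℓ` (Shimura 1971, Prop. 3.36 for `Γ(N) ⊆ Γ' ⊆ Γ(1)`, `(det α, N) = 1`: `deg Γ'αΓ' = deg Γ(1)αΓ(1) = ℓ + 1`; Miyake,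
  Thm. 5.3.5 and §5.3 for unit groups of orders of level `N` in indefinite quaternion algebras; Eichler 1973, Ch. II §6 Cor. 1: the number
  of integral left ideals of norm `n` prime to the level is `Σ_{d ∣ n} d`); globally every such ideal is principal with a generator of
  POSITIVE norm — the order `O` is locally norm-maximal (`nrd(O_p^×) = ℤ_p^×` at every `p`, the norm `𝔽_{q²}^× → 𝔽_q^×` being onto at `q ∈ C`),
  so `# Cls O = 1` and `nrd(O^×) = {±1}` (Voight, Cor. 28.5.17 with Thm. 28.5.3; Vignéras III §5 Cor. 5.7 and the norm theorem IV Thm. 1.1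
  for the hull Eichler order, transported to `O` through the residue description `O = {x ∈ O₀ : x mod q ∈ 𝔽_q[η_q] ∀ q ∈ C}` of the tree's
  `CartanTransport.ResiduePinning.mem_O_iff_residues`), whence left `O¹`-cosets of `O(ℓ)` ↔ left ideals of norm `ℓ`. At `D = 1`,
  `C = {q}` odd this is Kohen–Pacetti's Hecke operator `T_ℓ` on `X_ns(q; M)` (§1.3), of degree `ℓ + 1`.
* `cartanParametrizationData_deg_of_periods_mul` — **a parametrisation whose periods are divisible by `n` has degree divisible by `n²`,
  with quotient the degree of a parametrisation datum of the SAME curve.** If all `Γ`-periods of `Q.form` lie in `n·Λ_L` (`n ≥ 2`), the map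
  `Γτ ↦ uniformize(∫_{τ₀}^τ form)` factors as `[n] ∘ ψ` with `ψ = uniformize(n⁻¹ ∫ form)` a non-constant holomorphic map of compact Riemann
  surfaces (`Γ∖ℍ*` → `W(ℂ)`), so `deg = n² · deg ψ` (degree of a non-constant holomorphic map of compact Riemann surfaces and its
  multiplicativity: Farkas–Kra Prop. I.1.6; Forster Thm. 4.24 and 8.?; `deg [n] = n²`: Silverman AEC III.6.2 (d)); the datum `Q'` is
  `(L, uniformize, n⁻¹·form, τ₀, deg ψ)` (periods of `n⁻¹·form` in `Λ_L`; Hecke condition by linearity). In the tree the case `D > 1` of the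
  generic-fibre count behind `deg ψ` is `ShimuraCurveData.exists_deg_of_hasPeriodsIn` (`ShimuraCurveMapDegreeProofs.lean`) for Eichler level;
  the Cartan-level ∕ `D = 1` statement is this fact.

## Honest framing ∕ what these facts do NOT say

Both are standard and carry no arithmetic: nothing about degrees of class-minimal parametrisations beyond the divisibility by `n²` under
an `n`-divisibility of periods, no degree LAW, nothing about `Ш` or any curve's BSD. The first fact is stated for every `D` (including
`D = 1`) and every finite set `C` of Cartan places; at `ℓ ∣ D M ∏ C` nothing is asserted. DISCHARGE ROUTE (not attempted here): first
fact — the count `ℓ + 1` of right `O₀`-lattices of index `ℓ²` is the tree's `card_between_eq_succ` (`BrandtModuleSplitLattices.lean`),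
principal generators with positive norm are `ShimuraCurveData.exists_eq_units_smul_of_pos` (`D > 1`) on the hull, and the passage
hull ↔ Cartan order is the tree's residue calculus + strong approximation `CartanTransport.NormOneLift.exists_normOne_residues` (odd `q`);
second fact — port `ShimuraCurveData.exists_deg_of_hasPeriodsIn` to `CartanLevelCurveData` (cocompact case `D > 1`: the proof uses only
proper discontinuity and cocompactness of the group) and count fibres of `[n] ∘ ψ` over the `n²` preimage classes. Size: M + M.
presearch (tam3-p1 g27, corpus + galaxy): Hecke degree `ℓ + 1` for quaternionic ∕ Cartan groups — [corpus:book:andrianov2015-modular-forms-hecke-operators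
p. 95, 177] (coset counts), [corpus:book:cornell1997-modular-forms-fermats-last-theorem p. 135–143] (Hecke operators on modular curves and
Jacobians); no held text states the Cartan-level count verbatim (Kohen–Pacetti §1.3 defines the operators; Chen–Edixhoven compare with `X₀`).

## References

* G. Shimura, *Introduction to the arithmetic theory of automorphic functions* (1971), §3.3 Prop. 3.36, §3.4. [cite: ShimuraIATAF1971, Prop. 3.36 and §3.3]
* T. Miyake, *Modular Forms*, Springer (2006), §5.3 (Hecke algebras of unit groups of orders of indefinite quaternion algebras), Thm. 5.3.5. [cite: Miyake2006, §5.3 Thm. 5.3.5]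
* M. Eichler, *The basis problem for modular forms and the traces of the Hecke operators*, LNM 320 (1973), Ch. II §6 Cor. 1. [cite: Eichler1973, Ch. II §6 Cor. 1]
* J. Voight, *Quaternion Algebras*, GTM 288 (2021), Thm. 28.5.3, Cor. 28.5.17 (locally norm-maximal orders: `# Cls O = # Cl_Ω ℤ = 1`). [cite: Voight2021, Thm. 28.5.3 and Cor. 28.5.17]
* M.-F. Vignéras, *Arithmétique des algèbres de quaternions*, LNM 800 (1980), Ch. III §5 Cor. 5.7, Ch. IV §1 Thm. 1.1. [cite: VignerasLNM800, Ch. III §5 Cor. 5.7 and Ch. IV §1 Thm. 1.1]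
* D. Kohen, A. Pacetti, *Heegner points on Cartan non-split curves*, Canad. J. Math. 68 (2016) = arXiv:1403.7801v3, §1.3 (Hecke operators) and Rem. 3.8. [cite: KohenPacetti2016, §1.3 and Rem. 3.8]
* H. M. Farkas, I. Kra, *Riemann Surfaces*, GTM 71 (1992), Prop. I.1.6. [cite: FarkasKra1992, Prop. I.1.6]
* J. H. Silverman, *The Arithmetic of Elliptic Curves*, GTM 106 (2009), III.6.2 (d) (`deg [m] = m²`), II.2.3 (degrees multiply). [cite: SilvermanAEC2009, III.6.2 (d) and II.2.3]
-/

noncomputable section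

open scoped MatrixGroups UpperHalfPlane

namespace Literature.NumberTheory.Automorphic

/-- **Degree `ℓ + 1` of the Hecke correspondence `T_ℓ` on a Cartan-level Shimura curve at a good prime.** For a Cartan datum
`X : CartanLevelCurveData D M C` and a prime `ℓ ∤ D·M·∏_{q ∈ C} q`, the space of left `Γ`-cosets `Γ∖ι(O(ℓ))` (`Γ = ι(O¹)`,
`O(ℓ) = {x ∈ O : nrd x = ℓ}`; the index set of the tree's `X.heckeFun ℓ`) is finite with exactly `ℓ + 1` elements: locally the
`ℓ + 1` left ideals of reduced norm `ℓ` of `M₂(ℤ_ℓ)`, globally principal with positive-norm generators because `O` is locally norm-maximal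
(`# Cls O = 1`, `nrd(O^×) = {±1}`). [cite: ShimuraIATAF1971, Prop. 3.36 and §3.3] [cite: Miyake2006, §5.3 Thm. 5.3.5] [cite: Eichler1973, Ch. II §6 Cor. 1]
[cite: Voight2021, Thm. 28.5.3 and Cor. 28.5.17] [cite: KohenPacetti2016, §1.3] -/
def cartanLevel_card_heckeCosets_eq : Prop :=
  ∀ (D M : ℕ) (C : Finset ℕ) (X : CartanLevelCurveData D M C) (ℓ : ℕ), ℓ.Prime → ¬ ℓ ∣ D * M * ∏ q ∈ C, q →
    Finite (Quotient (X.heckeSetoid ℓ)) ∧ Nat.card (Quotient (X.heckeSetoid ℓ)) = ℓ + 1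

/-- **A parametrisation whose periods are divisible by `n` has degree `n²` times the degree of a parametrisation of the same curve.**
For `Q : CartanParametrizationData X W` and `n ≥ 2`: if every period `∫_z^{γz} Q.form` (`γ ∈ Γ`) is `n` times an element of the Néron
lattice `Λ_L` of `W`, then there is a datum `Q' : CartanParametrizationData X W` (same lattice, uniformisation and base point, form
`n⁻¹ · Q.form`) with `n² · Q'.deg = Q.deg` — the map of `Q` is `[n] ∘ ψ_{Q'}` and degrees of non-constant holomorphic maps of compact Riemann
surfaces multiply, `deg [n] = n²`. [cite: FarkasKra1992, Prop. I.1.6] [cite: SilvermanAEC2009, III.6.2 (d) and II.2.3] -/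
def cartanParametrizationData_deg_of_periods_mul : Prop :=
  ∀ (D M : ℕ) (C : Finset ℕ) (X : CartanLevelCurveData D M C) (W : WeierstrassCurve ℚ) [W.IsElliptic]
    (Q : CartanParametrizationData X W) (n : ℕ), 2 ≤ n →
    (∀ γ ∈ X.Gamma, ∀ z : ℍ, ∃ x ∈ Q.L.lattice, segmentIntegral Q.form z (γ • z) = (n : ℂ) * x) →
    ∃ Q' : CartanParametrizationData X W, n ^ 2 * Q'.deg = Q.deg

/-! ## Discharge of the first fact (appended; the statements above are unchanged)

`cartanLevel_card_heckeCosets_eq` is PROVED (cell `bsd-stepL`, seat `defn-ty1` g41): for a Cartan datum `X` and a prime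
`ℓ ∤ D M ∏_C q`, the coset space `Γ∖ι(O(ℓ))` is in bijection with the coset space `Γ₀∖ι(O₀(ℓ))` of the Eichler HULL datum
`X.toShimuraCurveData fd₀ h₀` (`ShimuraCurveCartanLevelHeckeCosets.lean`: injective by the saturation ∕ division-ring fields of
the datum, surjective by a norm-one hull unit obtained from Eichler–Kneser strong approximation with congruence conditions at the
Cartan primes), and the latter has `ℓ + 1` elements for EVERY discriminant `D` (`ShimuraCurveHeckeDegree.lean`: `D = 1` by the
split-case dictionary `Γ₀^1(M)∖ι(O(ℓ)) ≃ I_ℓ(M)`; `D > 1` by cosets ↔ principal left ideals of norm `ℓ` ↔ invertible right ideals of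
index `ℓ²` (Eichler's theorem), counted `1 + ℓ`). The second fact `cartanParametrizationData_deg_of_periods_mul` stays OPEN here. -/

/-- **`deg T_ℓ = ℓ + 1` on Cartan-level Shimura curves — PROVED.** For `X : CartanLevelCurveData D M C` and a prime
`ℓ ∤ D·M·∏_{q ∈ C} q`, `Γ∖ι(O(ℓ))` is finite with `ℓ + 1` elements: reduce to the hull datum
(`CartanLevelCurveData.natCard_quotient_heckeSetoid_eq_hull`) and count there
(`ShimuraCurveData.finite_and_natCard_quotient_heckeSetoid`). [cite: ShimuraIATAF1971, Prop. 3.36 and §3.3]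
[cite: Eichler1973, Ch. II §6 Cor. 1] [cite: KohenPacetti2016, §1.3] -/
theorem cartanLevel_card_heckeCosets_eq_holds : cartanLevel_card_heckeCosets_eq := by
  intro D M C X ℓ hℓ hℓDMC
  obtain ⟨fd₀, h₀⟩ := X.exists_isHypFundamentalDomain_hull
  have hℓDM : ¬ ℓ ∣ D * M := fun h => hℓDMC (dvd_mul_of_dvd_left h _)
  have hℓC : ∀ q ∈ C, q ≠ ℓ := fun q hq hqℓ =>
    hℓDMC (dvd_mul_of_dvd_right (hqℓ ▸ Finset.dvd_prod_of_mem (fun q : ℕ => q) hq) _)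
  obtain ⟨hcard, hfin⟩ := X.natCard_quotient_heckeSetoid_eq_hull fd₀ h₀ hℓ hℓC
  obtain ⟨hfin₀, hcard₀⟩ := (X.toShimuraCurveData fd₀ h₀).finite_and_natCard_quotient_heckeSetoid hℓ hℓDM
  exact ⟨hfin.mpr hfin₀, hcard.trans hcard₀⟩

/-! ## Discharge of the second fact (appended; the statements above are unchanged)

`cartanParametrizationData_deg_of_periods_mul` is PROVED (cell `bsd-stepL`, seat `defn-ty1` g41) for EVERY `D`: the degree of the
form `n⁻¹·Q.form` exists by `CartanLevelCurveData.exists_deg_of_hasPeriodsIn` (`ShimuraCurveCartanLevelMapDegree.lean`: Farkas–Kra on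
`ℍ`, cocompact for `D > 1`, cusp analysis for `D = 1`), and the fibre of `Γτ ↦ ∫ form = n·∫(n⁻¹ form)` over a class `w₀ + Λ` is the
DISJOINT union over the `n²` classes `(w₀ + aω₁ + bω₂)∕n + Λ` (`0 ≤ a, b < n`) of the fibres of `n⁻¹ form`; at a base value `w₀` off a
countable exceptional set (ℂ is uncountable) all `n² + 1` counts are generic, so `Q.deg = n²·d'`.
-- adapted from Summits/BirchSwinnertonDyer/BirchSwinnertonDyer/Theorems/ClassRecordThreeEulerHalvesAtThreeCartanCoverIsoDegree.lean
-- (tam3-p1 g27, the `D > 1` case `cartanParametrizationData_deg_of_periods_mul_of_one_lt`; Literature cannot import Summits — the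
-- [n]-fibre decomposition below is that file's, with the all-`D` degree theorem in place of the cocompact one). -/

namespace CartanParametrizationData

open scoped _root_.ModularForm _root_.Topology
open _root_.UpperHalfPlane _root_.Filter _root_.Set _root_.Function

variable {D M : ℕ} {C : Finset ℕ} {X : CartanLevelCurveData D M C} {W : WeierstrassCurve ℚ}
  (Q : CartanParametrizationData X W)

/-- `x − y ∈ Λ_L ↔ uniformize x = uniformize y` (the kernel of the uniformisation is the lattice). [folklore] -/
private theorem sub_mem_lattice_iff (x y : ℂ) : x - y ∈ Q.L.lattice ↔ Q.uniformize x = Q.uniformize y := by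
  rw [← sub_eq_zero, ← map_sub, ← AddMonoidHom.mem_ker]
  have h := Set.ext_iff.mp Q.ker_uniformize (x - y)
  exact h.symm

/-- **`Q.form ≠ 0`** for a Cartan-level parametrisation datum (else every point `≠ uniformize 0` has an empty fibre, `W(ℂ)`
would be finite and `ℂ` countable). [cite: KohenPacetti2016, Rem. 3.8 (arXiv:1403.7801v3 p. 15)] -/
theorem form_ne_zero [W.IsElliptic] : Q.form ≠ 0 := by
  classical
  intro h0'
  have h0 : (⇑Q.form : ℍ → ℂ) = 0 := by rw [h0']; rfl
  have hΨ : ∀ τ : ℍ, segmentIntegral Q.form Q.basePoint τ = 0 := fun τ => by simp [segmentIntegral, h0]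
  have hsub : (Set.univ : Set (W.baseChange ℂ).toAffine.Point) ⊆
      {P | Nat.card {y : MulAction.orbitRel.Quotient X.Gamma ℍ // ∃ τ : ℍ,
        (Quotient.mk _ τ : MulAction.orbitRel.Quotient X.Gamma ℍ) = y ∧
          Q.uniformize (segmentIntegral Q.form Q.basePoint τ) = P} ≠ Q.deg} ∪ {0} := by
    intro P _
    by_cases hP : P = 0
    · exact Or.inr hP
    · refine Or.inl ?_
      simp only [mem_setOf_eq]
      haveI : IsEmpty {y : MulAction.orbitRel.Quotient X.Gamma ℍ // ∃ τ : ℍ,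
          (Quotient.mk _ τ : MulAction.orbitRel.Quotient X.Gamma ℍ) = y ∧
            Q.uniformize (segmentIntegral Q.form Q.basePoint τ) = P} := by
        refine ⟨fun y => ?_⟩
        obtain ⟨τ, -, hτ⟩ := y.2
        apply hP
        rw [← hτ, hΨ, map_zero]
      rw [Nat.card_of_isEmpty]
      exact Q.deg_pos.ne
  have hfin : (Set.univ : Set (W.baseChange ℂ).toAffine.Point).Finite :=
    (Q.deg_spec.union (Set.finite_singleton 0)).subset hsub
  haveI : Countable Q.L.lattice := Countable.of_equiv _ Q.L.latticeEquivProd.toEquiv.symm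
  choose wP hwP using fun P => Q.uniformize_surjective P
  have hcount : (Set.univ : Set ℂ).Countable := by
    refine Set.Countable.mono (fun x _ => ?_)
      (hfin.countable.biUnion fun P _ => Set.countable_range (fun l : Q.L.lattice => wP P + (l : ℂ)))
    have hl : x - wP (Q.uniformize x) ∈ Q.L.lattice := by rw [sub_mem_lattice_iff Q, hwP]
    exact mem_iUnion₂.mpr ⟨Q.uniformize x, mem_univ _, ⟨x - wP _, hl⟩, add_sub_cancel _ _⟩
  exact not_countable_complex hcount

/-- Elements of `ι(O(ℓ))` have positive determinant `ℓ` (`ℓ ≥ 1`). [folklore] -/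
private theorem det_pos_of_mem_heckeSet {ℓ : ℕ} (hℓ : 0 < ℓ) {g : GL (Fin 2) ℝ} (hg : g ∈ X.heckeSet ℓ) :
    0 < g.det.val := by
  rw [Matrix.GeneralLinearGroup.val_det_apply, hg.2]
  exact_mod_cast hℓ

/-- **(ISO) at one datum**: if every `Γ`-period of `Q.form` is `n` times a lattice element (`n ≥ 2`), there is a datum `Q'` of the
same curve on `X` (form `n⁻¹·Q.form`, same lattice, uniformisation and base point) with `n²·Q'.deg = Q.deg`.
[cite: FarkasKra1992, Prop. I.1.6] [cite: SilvermanAEC2009, III.6.2 (d) and II.2.3] -/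
theorem deg_of_periods_mul [W.IsElliptic] (n : ℕ) (hn : 2 ≤ n)
    (hper : ∀ γ ∈ X.Gamma, ∀ z : ℍ, ∃ x ∈ Q.L.lattice, segmentIntegral Q.form z (γ • z) = (n : ℂ) * x) :
    ∃ Q' : CartanParametrizationData X W, n ^ 2 * Q'.deg = Q.deg := by
  classical
  have hn0 : (n : ℂ) ≠ 0 := by exact_mod_cast (show n ≠ 0 by omega)
  -- the form `n⁻¹ · Q.form`, its primitive and periods
  set F' : CuspForm X.Gamma 2 := (n : ℂ)⁻¹ • Q.form with hF'def
  have hF' : ∀ τ, F' τ = (n : ℂ)⁻¹ * Q.form τ := fun τ => by rw [hF'def, CuspForm.IsGLPos.smul_apply, smul_eq_mul]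
  have hseg : ∀ z w : ℍ, segmentIntegral F' z w = (n : ℂ)⁻¹ * segmentIntegral Q.form z w := by
    intro z w
    obtain ⟨H, hH⟩ := exists_hasDerivAt_primitive Q.form
    have hH' : ∀ u : ℂ, 0 < u.im → HasDerivAt (fun v => (n : ℂ)⁻¹ * H v) (F' (ofComplex u)) u := by
      intro u hu; rw [hF']; exact (hH u hu).const_mul _
    rw [segmentIntegral_eq_sub F' hH' z w, segmentIntegral_eq_sub Q.form hH z w]; ring
  have hper' : HasPeriodsIn X.Gamma (⇑F') (Q.L.lattice : Set ℂ) := by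
    intro γ hγ z
    obtain ⟨x, hx, hxe⟩ := hper γ hγ z
    rw [hseg, hxe, ← mul_assoc, inv_mul_cancel₀ hn0, one_mul]
    exact hx
  have hne' : (⇑F' : ℍ → ℂ) ≠ 0 := by
    intro h0
    apply Q.form_ne_zero
    apply DFunLike.coe_injective
    rw [CuspForm.coe_zero]
    funext τ
    have := congr_fun h0 τ
    rw [hF'] at this
    simpa [hn0] using this
  -- the degree of `F'` (every `D`)
  set τ₀ := Q.basePoint with hτ₀
  obtain ⟨d', hd'pos, hbad'⟩ := X.exists_deg_of_hasPeriodsIn F' hne' Q.L hper' τ₀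
  set Λ' : AddSubgroup ℂ := Q.L.lattice.toAddSubgroup with hΛ'
  set Ψ' : ℍ → ℂ := segmentIntegral F' τ₀ with hΨ'
  set S : ℂ → Set (MulAction.orbitRel.Quotient X.Gamma ℍ) :=
    fun w => {y | ∃ τ : ℍ, (Quotient.mk _ τ : MulAction.orbitRel.Quotient X.Gamma ℍ) = y ∧ Ψ' τ - w ∈ Q.L.lattice}
    with hSdef
  have hcardS : ∀ w : ℂ, Nat.card {y : MulAction.orbitRel.Quotient X.Gamma ℍ // ∃ τ : ℍ,
      (Quotient.mk _ τ : MulAction.orbitRel.Quotient X.Gamma ℍ) = y ∧ ((Ψ' τ : ℂ) : ℂ ⧸ Λ') = (w : ℂ ⧸ Λ')} =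
        Nat.card (S w) := by
    intro w
    refine Nat.card_congr (Equiv.subtypeEquivRight fun y => ?_)
    simp only [hSdef, mem_setOf_eq, QuotientAddGroup.eq_iff_sub_mem, hΛ', Submodule.mem_toAddSubgroup]
  have hgoodS : ∀ w : ℂ, ((w : ℂ) : ℂ ⧸ Λ') ∉ {c : ℂ ⧸ Λ' |
      Nat.card {y : MulAction.orbitRel.Quotient X.Gamma ℍ // ∃ τ : ℍ,
        (Quotient.mk _ τ : MulAction.orbitRel.Quotient X.Gamma ℍ) = y ∧
          ((segmentIntegral F' τ₀ τ : ℂ) : ℂ ⧸ Λ') = c} ≠ d'} → Nat.card (S w) = d' := by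
    intro w hw
    rw [← hcardS]
    by_contra h
    exact hw h
  -- the datum `Q'`
  refine ⟨{ L := Q.L
            isNeronLattice := Q.isNeronLattice
            uniformize := Q.uniformize
            ker_uniformize := Q.ker_uniformize
            uniformize_surjective := Q.uniformize_surjective
            uniformize_spec := Q.uniformize_spec
            form := F'
            basePoint := τ₀
            period_mem := hper'
            hecke_eq := ?_
            deg := d'
            deg_pos := hd'pos
            deg_spec := ?_ }, ?_⟩
  · -- Hecke: `T_ℓ (n⁻¹ f) = n⁻¹ T_ℓ f = a_ℓ · n⁻¹ f`
    intro ℓ hℓ hnd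
    have hQ := Q.hecke_eq ℓ hℓ hnd
    have hcoe : (⇑F' : ℍ → ℂ) = (n : ℂ)⁻¹ • (⇑Q.form : ℍ → ℂ) := by funext τ; rw [hF', Pi.smul_apply, smul_eq_mul]
    funext τ
    rw [hcoe]
    simp only [CartanLevelCurveData.heckeFun]
    have hsl : ∀ q : Quotient (X.heckeSetoid ℓ),
        (((n : ℂ)⁻¹ • (⇑Q.form : ℍ → ℂ)) ∣[(2 : ℤ)] ((q.out : X.heckeSet ℓ) : GL (Fin 2) ℝ)) τ =
          (n : ℂ)⁻¹ * ((⇑Q.form : ℍ → ℂ) ∣[(2 : ℤ)] ((q.out : X.heckeSet ℓ) : GL (Fin 2) ℝ)) τ := by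
      intro q
      rw [smul_slash_of_det_pos (det_pos_of_mem_heckeSet hℓ.pos (q.out : X.heckeSet ℓ).2), Pi.smul_apply, smul_eq_mul]
    simp_rw [hsl]
    rw [← mul_finsum, Pi.smul_apply, smul_eq_mul]
    have := congr_fun hQ τ
    simp only [CartanLevelCurveData.heckeFun] at this
    rw [this]; ring
  · -- `deg_spec` of `Q'`: bad points are images of bad classes
    refine (hbad'.image (fun c : ℂ ⧸ Λ' => Q.uniformize c.out)).subset ?_
    intro P hP
    obtain ⟨w, rfl⟩ := Q.uniformize_surjective P
    refine ⟨(w : ℂ ⧸ Λ'), ?_, ?_⟩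
    · simp only [mem_setOf_eq] at hP ⊢
      rw [hcardS w]
      intro h; apply hP
      rw [← h]
      refine Nat.card_congr (Equiv.subtypeEquivRight fun y => ?_)
      constructor
      · rintro ⟨τ, h1, h2⟩
        exact ⟨τ, h1, (sub_mem_lattice_iff Q _ _).mpr h2⟩
      · rintro ⟨τ, h1, h2⟩
        exact ⟨τ, h1, (sub_mem_lattice_iff Q _ _).mp h2⟩
    · rw [← sub_mem_lattice_iff Q, ← Submodule.mem_toAddSubgroup, ← hΛ', ← QuotientAddGroup.eq_iff_sub_mem,
        QuotientAddGroup.out_eq']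
  · -- the degree relation `n² d' = Q.deg`
    -- (a) decomposition of the `Ψ = n Ψ'`-fibre over `w₀` into the `Ψ'`-fibres over `(w₀ + a ω₁ + b ω₂)/n`
    set wab : ℂ → Fin n × Fin n → ℂ :=
      fun w₀ ab => (w₀ + ((ab.1 : ℕ) : ℂ) * Q.L.ω₁ + ((ab.2 : ℕ) : ℂ) * Q.L.ω₂) / (n : ℂ) with hwab
    have hT : ∀ w₀ : ℂ, {y : MulAction.orbitRel.Quotient X.Gamma ℍ | ∃ τ : ℍ,
        (Quotient.mk _ τ : MulAction.orbitRel.Quotient X.Gamma ℍ) = y ∧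
          segmentIntegral Q.form τ₀ τ - w₀ ∈ Q.L.lattice} = ⋃ ab : Fin n × Fin n, S (wab w₀ ab) := by
      intro w₀
      ext y
      simp only [mem_setOf_eq, mem_iUnion, hSdef]
      constructor
      · rintro ⟨τ, rfl, hτ⟩
        obtain ⟨p, q, hpq⟩ := PeriodPair.mem_lattice.mp hτ
        have hnpos : 0 < (n : ℤ) := by exact_mod_cast (show 0 < n by omega)
        refine ⟨(⟨(p % (n : ℤ)).toNat, ?_⟩, ⟨(q % (n : ℤ)).toNat, ?_⟩), τ, rfl, ?_⟩
        · have h1 := Int.emod_lt_of_pos p hnpos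
          have h2 := Int.emod_nonneg p hnpos.ne'
          omega
        · have h1 := Int.emod_lt_of_pos q hnpos
          have h2 := Int.emod_nonneg q hnpos.ne'
          omega
        · rw [PeriodPair.mem_lattice]
          refine ⟨p / (n : ℤ), q / (n : ℤ), ?_⟩
          have hp : (((p % (n : ℤ)).toNat : ℕ) : ℂ) = ((p % (n : ℤ) : ℤ) : ℂ) := by
            rw [← Int.cast_natCast, Int.toNat_of_nonneg (Int.emod_nonneg p hnpos.ne')]
          have hq : (((q % (n : ℤ)).toNat : ℕ) : ℂ) = ((q % (n : ℤ) : ℤ) : ℂ) := by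
            rw [← Int.cast_natCast, Int.toNat_of_nonneg (Int.emod_nonneg q hnpos.ne')]
          have ep : ((p : ℤ) : ℂ) - ((p % (n : ℤ) : ℤ) : ℂ) = (n : ℂ) * ((p / (n : ℤ) : ℤ) : ℂ) := by
            have := Int.emod_add_mul_ediv p (n : ℤ)
            have h' : ((p : ℤ) : ℂ) = ((p % (n : ℤ) : ℤ) : ℂ) + ((n : ℤ) : ℂ) * ((p / (n : ℤ) : ℤ) : ℂ) := by
              rw [← Int.cast_mul, ← Int.cast_add, this]
            rw [h']; push_cast; ring
          have eq' : ((q : ℤ) : ℂ) - ((q % (n : ℤ) : ℤ) : ℂ) = (n : ℂ) * ((q / (n : ℤ) : ℤ) : ℂ) := by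
            have := Int.emod_add_mul_ediv q (n : ℤ)
            have h' : ((q : ℤ) : ℂ) = ((q % (n : ℤ) : ℤ) : ℂ) + ((n : ℤ) : ℂ) * ((q / (n : ℤ) : ℤ) : ℂ) := by
              rw [← Int.cast_mul, ← Int.cast_add, this]
            rw [h']; push_cast; ring
          have hgoal : (n : ℂ) * (Ψ' τ - wab w₀ (⟨(p % (n : ℤ)).toNat, by
              have h1 := Int.emod_lt_of_pos p hnpos; have h2 := Int.emod_nonneg p hnpos.ne'; omega⟩,
              ⟨(q % (n : ℤ)).toNat, by
                have h1 := Int.emod_lt_of_pos q hnpos; have h2 := Int.emod_nonneg q hnpos.ne'; omega⟩)) =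
              segmentIntegral Q.form τ₀ τ - w₀ - ((p % (n : ℤ) : ℤ) : ℂ) * Q.L.ω₁ - ((q % (n : ℤ) : ℤ) : ℂ) * Q.L.ω₂ := by
            simp only [hwab, hp, hq]
            rw [hΨ', hseg]
            field_simp
            ring
          apply mul_left_cancel₀ hn0
          rw [hgoal]
          linear_combination hpq - Q.L.ω₁ * ep - Q.L.ω₂ * eq'
      · rintro ⟨ab, τ, rfl, hτ⟩
        refine ⟨τ, rfl, ?_⟩
        have e : segmentIntegral Q.form τ₀ τ - w₀ =
            (n : ℂ) * (Ψ' τ - wab w₀ ab) + (((ab.1 : ℕ) : ℤ) : ℂ) * Q.L.ω₁ + (((ab.2 : ℕ) : ℤ) : ℂ) * Q.L.ω₂ := by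
          rw [hΨ', hseg, hwab]
          field_simp
          push_cast
          ring
        rw [e]
        refine Q.L.lattice.add_mem (Q.L.lattice.add_mem ?_ ?_) ?_
        · have : (n : ℂ) * (Ψ' τ - wab w₀ ab) = (n : ℤ) • (Ψ' τ - wab w₀ ab) := by rw [zsmul_eq_mul]; push_cast; ring
          rw [this]; exact Q.L.lattice.smul_mem _ hτ
        · rw [← zsmul_eq_mul]; exact Q.L.lattice.smul_mem _ Q.L.ω₁_mem_lattice
        · rw [← zsmul_eq_mul]; exact Q.L.lattice.smul_mem _ Q.L.ω₂_mem_lattice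
    -- (b) disjointness
    have hdisj : ∀ w₀ : ℂ, ∀ ab ab' : Fin n × Fin n, ab ≠ ab' → Disjoint (S (wab w₀ ab)) (S (wab w₀ ab')) := by
      intro w₀ ab ab' hne
      rw [Set.disjoint_left]
      rintro y ⟨τ, rfl, hτ⟩ ⟨τ', hττ', hτ'⟩
      apply hne
      have horb : Ψ' τ' - Ψ' τ ∈ Q.L.lattice := by
        obtain ⟨γ, rfl⟩ := Quotient.exact hττ'
        rw [hΨ', segmentIntegral_sub_segmentIntegral F' τ₀ τ (γ • τ)]
        exact hper' γ γ.2 τ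
      have hdiff : wab w₀ ab - wab w₀ ab' ∈ Q.L.lattice := by
        have e : wab w₀ ab - wab w₀ ab' = (Ψ' τ' - wab w₀ ab') - (Ψ' τ - wab w₀ ab) - (Ψ' τ' - Ψ' τ) := by ring
        rw [e]; exact Q.L.lattice.sub_mem (Q.L.lattice.sub_mem hτ' hτ) horb
      have e2 : wab w₀ ab - wab w₀ ab' =
          ((((ab.1 : ℕ) : ℚ) - ((ab'.1 : ℕ) : ℚ)) / n : ℚ) * Q.L.ω₁ + ((((ab.2 : ℕ) : ℚ) - ((ab'.2 : ℕ) : ℚ)) / n : ℚ) * Q.L.ω₂ := by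
        simp only [hwab]; push_cast; field_simp; ring
      rw [e2, PeriodPair.mul_ω₁_add_mul_ω₂_mem_lattice] at hdiff
      obtain ⟨h1, h2⟩ := hdiff
      have key : ∀ (a a' : Fin n), ((((a : ℕ) : ℚ) - ((a' : ℕ) : ℚ)) / n : ℚ).den = 1 → a = a' := by
        intro a a' h
        have hnq : (n : ℚ) ≠ 0 := by exact_mod_cast (show n ≠ 0 by omega)
        set r : ℚ := (((a : ℕ) : ℚ) - ((a' : ℕ) : ℚ)) / n with hr
        have hnum : (r.num : ℚ) = r := (Rat.den_eq_one_iff r).mp h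
        have hq' : ((a : ℕ) : ℚ) - ((a' : ℕ) : ℚ) = (r.num : ℚ) * (n : ℚ) := by
          rw [hnum, hr, div_mul_cancel₀ _ hnq]
        have hk' : ((a : ℕ) : ℤ) - ((a' : ℕ) : ℤ) = r.num * (n : ℤ) := by exact_mod_cast hq'
        have ha := a.2; have ha' := a'.2
        have hk0 : r.num = 0 := by
          by_contra hk0
          have h1 : (n : ℤ) ≤ |((a : ℕ) : ℤ) - ((a' : ℕ) : ℤ)| := by
            rw [hk', abs_mul, Nat.abs_cast]
            exact le_mul_of_one_le_left (by positivity) (Int.one_le_abs hk0)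
          have h2 : |((a : ℕ) : ℤ) - ((a' : ℕ) : ℤ)| < n := by rw [abs_sub_lt_iff]; constructor <;> omega
          omega
        rw [hk0, zero_mul, sub_eq_zero] at hk'
        exact Fin.ext (by exact_mod_cast hk')
      exact Prod.ext (key _ _ h1) (key _ _ h2)
    -- (c) a generic base value `w₀`
    have hbadQ := Q.deg_spec
    haveI : Countable Q.L.lattice := Countable.of_equiv _ Q.L.latticeEquivProd.toEquiv.symm
    set badC : Set (ℂ ⧸ Λ') := {c : ℂ ⧸ Λ' | Nat.card {y : MulAction.orbitRel.Quotient X.Gamma ℍ // ∃ τ : ℍ,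
      (Quotient.mk _ τ : MulAction.orbitRel.Quotient X.Gamma ℍ) = y ∧
        ((segmentIntegral F' τ₀ τ : ℂ) : ℂ ⧸ Λ') = c} ≠ d'} with hbadC
    set E₁ : Set ℂ := ⋃ ab : Fin n × Fin n, {w₀ | ((wab w₀ ab : ℂ) : ℂ ⧸ Λ') ∈ badC} with hE₁
    set E₂ : Set ℂ := Q.uniformize ⁻¹' {P | Nat.card {y : MulAction.orbitRel.Quotient X.Gamma ℍ // ∃ τ : ℍ,
      (Quotient.mk _ τ : MulAction.orbitRel.Quotient X.Gamma ℍ) = y ∧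
        Q.uniformize (segmentIntegral Q.form Q.basePoint τ) = P} ≠ Q.deg} with hE₂
    have hE₁c : E₁.Countable := by
      refine Set.countable_iUnion fun ab => ?_
      refine Set.Countable.mono (fun w₀ hw₀ => ?_)
        (hbad'.countable.biUnion fun c _ => Set.countable_range (fun l : Q.L.lattice =>
          (n : ℂ) * ((c : ℂ ⧸ Λ').out + (l : ℂ)) - ((ab.1 : ℕ) : ℂ) * Q.L.ω₁ - ((ab.2 : ℕ) : ℂ) * Q.L.ω₂))
      have hmem : ((wab w₀ ab : ℂ) : ℂ ⧸ Λ') ∈ badC := hw₀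
      have hl : wab w₀ ab - ((wab w₀ ab : ℂ) : ℂ ⧸ Λ').out ∈ Q.L.lattice := by
        rw [← Submodule.mem_toAddSubgroup, ← hΛ', ← QuotientAddGroup.eq_iff_sub_mem, QuotientAddGroup.out_eq']
      refine mem_iUnion₂.mpr ⟨_, hmem, ⟨wab w₀ ab - ((wab w₀ ab : ℂ) : ℂ ⧸ Λ').out, hl⟩, ?_⟩
      simp only [hwab]
      field_simp
      ring
    have hE₂c : E₂.Countable := by
      choose wP hwP using fun P => Q.uniformize_surjective P
      refine Set.Countable.mono (fun x hx => ?_)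
        (hbadQ.countable.biUnion fun P _ => Set.countable_range (fun l : Q.L.lattice => wP P + (l : ℂ)))
      have hl : x - wP (Q.uniformize x) ∈ Q.L.lattice := by rw [sub_mem_lattice_iff Q, hwP]
      exact mem_iUnion₂.mpr ⟨Q.uniformize x, hx, ⟨x - wP _, hl⟩, add_sub_cancel _ _⟩
    obtain ⟨w₀, hw₀⟩ : (E₁ ∪ E₂)ᶜ.Nonempty := by
      by_contra h
      rw [Set.not_nonempty_iff_eq_empty, Set.compl_empty_iff] at h
      exact not_countable_complex (by rw [← h]; exact hE₁c.union hE₂c)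
    rw [Set.mem_compl_iff, Set.mem_union, not_or] at hw₀
    obtain ⟨hw₁, hw₂⟩ := hw₀
    -- (d) the counts at `w₀`
    have hSab : ∀ ab : Fin n × Fin n, Nat.card (S (wab w₀ ab)) = d' := by
      intro ab
      apply hgoodS
      intro h
      exact hw₁ (mem_iUnion.mpr ⟨ab, h⟩)
    have hfinab : ∀ ab : Fin n × Fin n, (S (wab w₀ ab)).Finite := fun ab =>
      Nat.finite_of_card_ne_zero (by rw [hSab ab]; exact hd'pos.ne')
    have hQdeg : Nat.card {y : MulAction.orbitRel.Quotient X.Gamma ℍ // ∃ τ : ℍ,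
        (Quotient.mk _ τ : MulAction.orbitRel.Quotient X.Gamma ℍ) = y ∧
          Q.uniformize (segmentIntegral Q.form Q.basePoint τ) = Q.uniformize w₀} = Q.deg := by
      by_contra h
      exact hw₂ h
    have hTcard : Nat.card {y : MulAction.orbitRel.Quotient X.Gamma ℍ // ∃ τ : ℍ,
        (Quotient.mk _ τ : MulAction.orbitRel.Quotient X.Gamma ℍ) = y ∧
          Q.uniformize (segmentIntegral Q.form Q.basePoint τ) = Q.uniformize w₀} =
        Nat.card (⋃ ab : Fin n × Fin n, S (wab w₀ ab)) := by
      rw [← hT w₀]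
      refine Nat.card_congr (Equiv.subtypeEquivRight fun y => ?_)
      constructor
      · rintro ⟨τ, h1, h2⟩
        exact ⟨τ, h1, (sub_mem_lattice_iff Q _ _).mpr h2⟩
      · rintro ⟨τ, h1, h2⟩
        exact ⟨τ, h1, (sub_mem_lattice_iff Q _ _).mp h2⟩
    have hUcard : Nat.card (⋃ ab : Fin n × Fin n, S (wab w₀ ab)) = ∑ ab : Fin n × Fin n, Nat.card (S (wab w₀ ab)) := by
      rw [Nat.card_coe_set_eq, Set.ncard_iUnion_of_finite hfinab (fun ab ab' hne => hdisj w₀ ab ab' hne),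
        finsum_eq_sum_of_fintype]
      simp only [Nat.card_coe_set_eq]
    rw [hTcard, hUcard] at hQdeg
    simp only [hSab, Finset.sum_const, Finset.card_univ, Fintype.card_prod, Fintype.card_fin, smul_eq_mul] at hQdeg
    rw [← hQdeg]; ring

end CartanParametrizationData

/-- **A parametrisation whose periods are divisible by `n` has degree `n²` times the degree of a parametrisation of the same curve —
PROVED, every level `(D, M; C)`** (Farkas–Kra Prop. I.1.6 for `Γ∖ℍ* → ℂ∕Λ_L` via `CartanLevelCurveData.exists_deg_of_hasPeriodsIn`,
and `deg [n] = n²` as the count of the `n²` classes `(w₀ + aω₁ + bω₂)∕n`). [cite: FarkasKra1992, Prop. I.1.6]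
[cite: SilvermanAEC2009, III.6.2 (d) and II.2.3] -/
theorem cartanParametrizationData_deg_of_periods_mul_holds : cartanParametrizationData_deg_of_periods_mul := by
  intro D M C X W _ Q n hn hper
  exact Q.deg_of_periods_mul n hn hper

end Literature.NumberTheory.Automorphic

end
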